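import Summits.BirchSwinnertonDyer.BirchSwinnertonDyer.Theorems.SignedLowerHalvesSprungLowerHalfAtThreeSelmerNineShape
import Summits.BirchSwinnertonDyer.Rank1Residual.Supersingular.RankZeroSurjThreeCertificates_02
import Summits.BirchSwinnertonDyer.Rank1Residual.Supersingular.RankZeroSurjThreeCertificates_03
import HarnessLib

/-!
# Route `SignedLowerHalves`, crux `SprungLowerHalfAtThree` (item stmt-BirchSwinnertonDyer-19003), its LEAF
# BRANCH `r_an = 0 ∧ surj(3)` PER PAIR — RECORDS part D of 4: `BSD(E,3)` for `16606f1`, `16688c1`, `17200bj1`, `17600bz1`, `17602a1`, `17986l1`, `18032g1`, `18032h1`, `18515u1`, `18656b1`, `19600eb1`, `19760m1`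
# from PUBLISHED facts + the landed two-engine `3`-descent rows (cell `bsd-ssimc`, seat `bsd-ssimc-k3-c5`
# gen 5; a `--supports … --as helper` file; closes nothing about the crux)

PARTITION (cell bsd-ssimc): X8 (A8) × 12 of the 49 window cells `r_an = 0 ∧ surj(3) ∧ ord₃ #Ш_an = 2`
(all 49 have `N < 2·10⁴`; 48 of them carried ONLY the K25-conditional offer `bsdp_x8r0kp3_*` before, and
`11123a1` — crux 5's BC5 «first value» pair — carried no `BSDp` theorem at all) — closes PER PAIR (OFFERS;
the desk books, nothing is booked here); types nothing new; crux 5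
(`Summit.BirchSwinnertonDyer.BirchSwinnertonDyer.Theses.SignedLowerHalves.SprungLowerHalfAtThree`) stays OPEN
(clause (A) = modularity, `…Characterization.lean`). HONEST FRAMING: BSD is not proved by any of this;
nothing here is new mathematics — the road is cell `b2b-bsdres`'s (consumer
`Supersingular.X8.bsdp_rankZero_of_casselsTate_of_selmerGroup_ne_bot_of_surj`, `DescentLowerBound.lean`;
rows `Supersingular/X8DescentRecords.lean`, x10b gen 5, kit j091546: engine 1 = x11b `desc3lib.gp` EXACT-3,
engine 2 = `desc3full_e2.py`, `dim_𝔽₃ Sel^(3)(E/ℚ) = 2` on both, same `𝔽₃`-subspace of `A^×/A^{×3}`);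
this seat only types the per-pair theorems that were never written off those rows. THEOREMS ONLY (no
definition, no named fact, no `sorry`).

Each record instantiates `X8.bsdp_three_rankZero_of_ainvs_of_selmerGroup_ne_bot_of_surj` (`…SelmerNineShape.lean`)
on the literal Cremona model: global minimality (bounded Kraus criterion), `3 ∤ Δ` and `#Ẽ(𝔽₃) ∈ {1, 7}`
are DECIDED by the kernel; `ρ̄_{E,3}` onto is the landed certificate `surj_x8r0_<label>_3`
(`RankZeroSurjThreeCertificates_0*`). What REMAINS displayed: the PUBLISHED named facts `hCT`
(Cassels–Tate), `hW` (Wuthrich 2014 Prop. 21), `hGZK`, `hmod`; per pair `hr` (`r_an = 0`, Cremona),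
`hq`/`hv` (`#Ш_an = q`, `ord₃ q ≤ 2`; here `#Ш_an = 9`), and the certificate line `hSel : Sel^(3)(E/ℚ) ≠ ⊥`
whose EVIDENCE is the landed row named in each docstring (`checked_x8_rankZero_sha9_desc3_k`, cert sha256
prefix) — the same tier as the tree's other flag-free per-pair A8 theorems (`bsdp3_b1n_*`, `bsdp3_nn*`).
Mathematics of the chain (all PROVED in the tree below the named facts): `r = 0` (GZK) and `E(ℚ)[3] = 0`
(`E[3]` irreducible on X8) make `Sel^(3)(E/ℚ) ↪ Ш[3]`, so `Ш[3] ≠ 0`, `3 ∣ #Ш`, `9 ∣ #Ш` (Cassels–Tate) =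
`ord₃ #Ш_an ≤ ord₃ #Ш`; Wuthrich's Prop. 21 (image onto) gives `≥`.

References: [Wuthrich2014] Prop. 21; [SilvermanAEC2009] Thm. X.4.14, VII.1 Rem. 1.1, VII.5 Prop. 5.1(a);
[Serre1972] §1.11 Prop. 12, §2.4 Prop. 15; [Miller2011LMS] Def. 1.1; [Cremona2006] Table 1; Schaefer–Stoll,
Trans. AMS 356 (2004) (the descent engines' method).
-/

set_option autoImplicit false
set_option linter.dupNamespace false

noncomputable section

open scoped Classical

open WeierstrassCurve Literature.NumberTheory.EllipticCurves
  Literature.NumberTheory.EllipticCurves.Rank1Residual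
  Literature.NumberTheory.EllipticCurves.Rank1Residual.Typed
  Literature.NumberTheory.EllipticCurves.Rank1Residual.X11RankOneCertificates
  Literature.NumberTheory.EllipticCurves.Wuthrich2014
  Summit.BirchSwinnertonDyer.BirchSwinnertonDyer.Rank1Residual.X11RankOne
  Summit.BirchSwinnertonDyer.Rank1Residual.Supersingular

namespace Summit.BirchSwinnertonDyer.BirchSwinnertonDyer.Theorems

/-- **`BSD(E,3)` for `16606f1`** — X8 ∩ {r_an = 0} ∩ {surj(3)}, `#Ш_an = 9`; Cremona model `[1,-1,0,-2294764,-1337370928]`,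
`N = 16606 = 2·19²·23`, good supersingular at `3` with `a₃ = 3`, `ρ̄_{E,3}` onto (`surj_x8r0_16606f1_3`), `#E(ℚ)_tors = 1`,
`∏ c_ℓ = 2`. Kernel-decided: global minimality (the bounded Kraus certificate of `surj_x8r0_16606f1_3`, verbatim), `3 ∤ Δ`, `#Ẽ(𝔽₃) = 1`. Binders: PUBLISHED `hCT`,
`hW`, `hGZK`, `hmod`; per pair `hr`, `hq`/`hv` (`#Ш_an = 9`), `hSel : Sel^(3)(E/ℚ) ≠ ⊥` — EVIDENCE: the landed
two-engine exact `3`-descent row of `16606f1` in `Supersingular/X8DescentRecords.lean` (`checked_x8_rankZero_sha9_desc3_4`;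
`dim_𝔽₃ Sel^(3) = 2` on both engines, same subspace; cert `6457a76185eb…`; kit j091546). Per pair; OFFER (the
desk books); class X8 and crux 5 unchanged. [cite: Wuthrich2014, Prop. 21 (p. 400)]
[cite: SilvermanAEC2009, Thm. X.4.14 and VII.1 Remark 1.1] [cite: Miller2011LMS, §1 and Def. 1.1]
[cite: Cremona2006, Table 1 (Cremona label 16606f1)] -/
theorem X8.bsdp3_sel9_16606f1 (hCT : exists_casselsTate_pairing (K := ℚ)) (hW : sha_dvd_analyticSha)
    (hGZK : rank_eq_analyticRank_of_analyticRank_le_one) (hmod : hasEntireLFunction_rat)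
    (W : WeierstrassCurve ℚ) (hWm : W = ⟨1, -1, 0, -2294764, -1337370928⟩) (hr : W.analyticRank = 0)
    {q : ℚ} (hq : shaAn W = (q : ℂ)) (hv : padicValRat 3 q ≤ 2) (hSel : W.selmerGroup (3 : ℤ) ≠ ⊥) :
    BSDp W 3 := by
  subst hWm
  exact X8.bsdp_three_rankZero_of_ainvs_of_selmerGroup_ne_bot_of_surj hCT hW hGZK hmod
    1 (-1) 0 (-2294764) (-1337370928)
    (isGloballyMinimal_of_krausCriterion_bounded 1 (-1) 0 (-2294764) (-1337370928)
      (by decide +kernel) (by decide +kernel) (by decide +kernel))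
    (by decide) (n₃ := 1) (by decide +kernel) (by decide) surj_x8r0_16606f1_3 hr hq hv hSel

/-- **`BSD(E,3)` for `16688c1`** — X8 ∩ {r_an = 0} ∩ {surj(3)}, `#Ш_an = 9`; Cremona model `[0,0,0,-460,-3988]`,
`N = 16688 = 2⁴·7·149`, good supersingular at `3` with `a₃ = 3`, `ρ̄_{E,3}` onto (`surj_x8r0_16688c1_3`), `#E(ℚ)_tors = 1`,
`∏ c_ℓ = 1`. Kernel-decided: global minimality (the bounded Kraus certificate of `surj_x8r0_16688c1_3`, verbatim), `3 ∤ Δ`, `#Ẽ(𝔽₃) = 1`. Binders: PUBLISHED `hCT`,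
`hW`, `hGZK`, `hmod`; per pair `hr`, `hq`/`hv` (`#Ш_an = 9`), `hSel : Sel^(3)(E/ℚ) ≠ ⊥` — EVIDENCE: the landed
two-engine exact `3`-descent row of `16688c1` in `Supersingular/X8DescentRecords.lean` (`checked_x8_rankZero_sha9_desc3_4`;
`dim_𝔽₃ Sel^(3) = 2` on both engines, same subspace; cert `11e671e01eca…`; kit j091546). Per pair; OFFER (the
desk books); class X8 and crux 5 unchanged. [cite: Wuthrich2014, Prop. 21 (p. 400)]
[cite: SilvermanAEC2009, Thm. X.4.14 and VII.1 Remark 1.1] [cite: Miller2011LMS, §1 and Def. 1.1]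
[cite: Cremona2006, Table 1 (Cremona label 16688c1)] -/
theorem X8.bsdp3_sel9_16688c1 (hCT : exists_casselsTate_pairing (K := ℚ)) (hW : sha_dvd_analyticSha)
    (hGZK : rank_eq_analyticRank_of_analyticRank_le_one) (hmod : hasEntireLFunction_rat)
    (W : WeierstrassCurve ℚ) (hWm : W = ⟨0, 0, 0, -460, -3988⟩) (hr : W.analyticRank = 0)
    {q : ℚ} (hq : shaAn W = (q : ℂ)) (hv : padicValRat 3 q ≤ 2) (hSel : W.selmerGroup (3 : ℤ) ≠ ⊥) :
    BSDp W 3 := by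
  subst hWm
  exact X8.bsdp_three_rankZero_of_ainvs_of_selmerGroup_ne_bot_of_surj hCT hW hGZK hmod
    0 0 0 (-460) (-3988)
    (isGloballyMinimal_of_krausCriterion_bounded 0 0 0 (-460) (-3988)
      (by decide +kernel) (by decide +kernel) (by decide +kernel))
    (by decide) (n₃ := 1) (by decide +kernel) (by decide) surj_x8r0_16688c1_3 hr hq hv hSel

/-- **`BSD(E,3)` for `17200bj1`** — X8 ∩ {r_an = 0} ∩ {surj(3)}, `#Ш_an = 9`; Cremona model `[0,0,0,-4862875,-4127533750]`,
`N = 17200 = 2⁴·5²·43`, good supersingular at `3` with `a₃ = 3`, `ρ̄_{E,3}` onto (`surj_x8r0_17200bj1_3`), `#E(ℚ)_tors = 1`,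
`∏ c_ℓ = 12`. Kernel-decided: global minimality (the bounded Kraus certificate of `surj_x8r0_17200bj1_3`, verbatim), `3 ∤ Δ`, `#Ẽ(𝔽₃) = 1`. Binders: PUBLISHED `hCT`,
`hW`, `hGZK`, `hmod`; per pair `hr`, `hq`/`hv` (`#Ш_an = 9`), `hSel : Sel^(3)(E/ℚ) ≠ ⊥` — EVIDENCE: the landed
two-engine exact `3`-descent row of `17200bj1` in `Supersingular/X8DescentRecords.lean` (`checked_x8_rankZero_sha9_desc3_4`;
`dim_𝔽₃ Sel^(3) = 2` on both engines, same subspace; cert `2e6ceb3892e3…`; kit j091546). Per pair; OFFER (the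
desk books); class X8 and crux 5 unchanged. [cite: Wuthrich2014, Prop. 21 (p. 400)]
[cite: SilvermanAEC2009, Thm. X.4.14 and VII.1 Remark 1.1] [cite: Miller2011LMS, §1 and Def. 1.1]
[cite: Cremona2006, Table 1 (Cremona label 17200bj1)] -/
theorem X8.bsdp3_sel9_17200bj1 (hCT : exists_casselsTate_pairing (K := ℚ)) (hW : sha_dvd_analyticSha)
    (hGZK : rank_eq_analyticRank_of_analyticRank_le_one) (hmod : hasEntireLFunction_rat)
    (W : WeierstrassCurve ℚ) (hWm : W = ⟨0, 0, 0, -4862875, -4127533750⟩) (hr : W.analyticRank = 0)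
    {q : ℚ} (hq : shaAn W = (q : ℂ)) (hv : padicValRat 3 q ≤ 2) (hSel : W.selmerGroup (3 : ℤ) ≠ ⊥) :
    BSDp W 3 := by
  subst hWm
  exact X8.bsdp_three_rankZero_of_ainvs_of_selmerGroup_ne_bot_of_surj hCT hW hGZK hmod
    0 0 0 (-4862875) (-4127533750)
    (isGloballyMinimal_of_krausCriterion₃_bounded 0 0 0 (-4862875) (-4127533750)
      (by decide +kernel) (by decide +kernel)
      (by set_option synthInstance.maxSize 2000 in decide +kernel))
    (by decide) (n₃ := 1) (by decide +kernel) (by decide) surj_x8r0_17200bj1_3 hr hq hv hSel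

/-- **`BSD(E,3)` for `17600bz1`** — X8 ∩ {r_an = 0} ∩ {surj(3)}, `#Ш_an = 9`; Cremona model `[0,0,0,-400,-4000]`,
`N = 17600 = 2⁶·5²·11`, good supersingular at `3` with `a₃ = 3`, `ρ̄_{E,3}` onto (`surj_x8r0_17600bz1_3`), `#E(ℚ)_tors = 1`,
`∏ c_ℓ = 1`. Kernel-decided: global minimality (the bounded Kraus certificate of `surj_x8r0_17600bz1_3`, verbatim), `3 ∤ Δ`, `#Ẽ(𝔽₃) = 1`. Binders: PUBLISHED `hCT`,
`hW`, `hGZK`, `hmod`; per pair `hr`, `hq`/`hv` (`#Ш_an = 9`), `hSel : Sel^(3)(E/ℚ) ≠ ⊥` — EVIDENCE: the landed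
two-engine exact `3`-descent row of `17600bz1` in `Supersingular/X8DescentRecords.lean` (`checked_x8_rankZero_sha9_desc3_4`;
`dim_𝔽₃ Sel^(3) = 2` on both engines, same subspace; cert `0049d116dfcf…`; kit j091546). Per pair; OFFER (the
desk books); class X8 and crux 5 unchanged. [cite: Wuthrich2014, Prop. 21 (p. 400)]
[cite: SilvermanAEC2009, Thm. X.4.14 and VII.1 Remark 1.1] [cite: Miller2011LMS, §1 and Def. 1.1]
[cite: Cremona2006, Table 1 (Cremona label 17600bz1)] -/
theorem X8.bsdp3_sel9_17600bz1 (hCT : exists_casselsTate_pairing (K := ℚ)) (hW : sha_dvd_analyticSha)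
    (hGZK : rank_eq_analyticRank_of_analyticRank_le_one) (hmod : hasEntireLFunction_rat)
    (W : WeierstrassCurve ℚ) (hWm : W = ⟨0, 0, 0, -400, -4000⟩) (hr : W.analyticRank = 0)
    {q : ℚ} (hq : shaAn W = (q : ℂ)) (hv : padicValRat 3 q ≤ 2) (hSel : W.selmerGroup (3 : ℤ) ≠ ⊥) :
    BSDp W 3 := by
  subst hWm
  exact X8.bsdp_three_rankZero_of_ainvs_of_selmerGroup_ne_bot_of_surj hCT hW hGZK hmod
    0 0 0 (-400) (-4000)
    (isGloballyMinimal_of_krausCriterion₃_bounded 0 0 0 (-400) (-4000)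
      (by decide +kernel) (by decide +kernel)
      (by set_option synthInstance.maxSize 2000 in decide +kernel))
    (by decide) (n₃ := 1) (by decide +kernel) (by decide) surj_x8r0_17600bz1_3 hr hq hv hSel

/-- **`BSD(E,3)` for `17602a1`** — X8 ∩ {r_an = 0} ∩ {surj(3)}, `#Ш_an = 9`; Cremona model `[1,-1,0,-6628,-210352]`,
`N = 17602 = 2·13·677`, good supersingular at `3` with `a₃ = 3`, `ρ̄_{E,3}` onto (`surj_x8r0_17602a1_3`), `#E(ℚ)_tors = 1`,
`∏ c_ℓ = 2`. Kernel-decided: global minimality (the bounded Kraus certificate of `surj_x8r0_17602a1_3`, verbatim), `3 ∤ Δ`, `#Ẽ(𝔽₃) = 1`. Binders: PUBLISHED `hCT`,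
`hW`, `hGZK`, `hmod`; per pair `hr`, `hq`/`hv` (`#Ш_an = 9`), `hSel : Sel^(3)(E/ℚ) ≠ ⊥` — EVIDENCE: the landed
two-engine exact `3`-descent row of `17602a1` in `Supersingular/X8DescentRecords.lean` (`checked_x8_rankZero_sha9_desc3_4`;
`dim_𝔽₃ Sel^(3) = 2` on both engines, same subspace; cert `8496ff791bd3…`; kit j091546). Per pair; OFFER (the
desk books); class X8 and crux 5 unchanged. [cite: Wuthrich2014, Prop. 21 (p. 400)]
[cite: SilvermanAEC2009, Thm. X.4.14 and VII.1 Remark 1.1] [cite: Miller2011LMS, §1 and Def. 1.1]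
[cite: Cremona2006, Table 1 (Cremona label 17602a1)] -/
theorem X8.bsdp3_sel9_17602a1 (hCT : exists_casselsTate_pairing (K := ℚ)) (hW : sha_dvd_analyticSha)
    (hGZK : rank_eq_analyticRank_of_analyticRank_le_one) (hmod : hasEntireLFunction_rat)
    (W : WeierstrassCurve ℚ) (hWm : W = ⟨1, -1, 0, -6628, -210352⟩) (hr : W.analyticRank = 0)
    {q : ℚ} (hq : shaAn W = (q : ℂ)) (hv : padicValRat 3 q ≤ 2) (hSel : W.selmerGroup (3 : ℤ) ≠ ⊥) :
    BSDp W 3 := by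
  subst hWm
  exact X8.bsdp_three_rankZero_of_ainvs_of_selmerGroup_ne_bot_of_surj hCT hW hGZK hmod
    1 (-1) 0 (-6628) (-210352)
    (isGloballyMinimal_of_krausCriterion_bounded 1 (-1) 0 (-6628) (-210352)
      (by decide +kernel) (by decide +kernel) (by decide +kernel))
    (by decide) (n₃ := 1) (by decide +kernel) (by decide) surj_x8r0_17602a1_3 hr hq hv hSel

/-- **`BSD(E,3)` for `17986l1`** — X8 ∩ {r_an = 0} ∩ {surj(3)}, `#Ш_an = 9`; Cremona model `[1,-1,1,165,-16391]`,
`N = 17986 = 2·17·23²`, good supersingular at `3` with `a₃ = 3`, `ρ̄_{E,3}` onto (`surj_x8r0_17986l1_3`), `#E(ℚ)_tors = 1`,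
`∏ c_ℓ = 2`. Kernel-decided: global minimality (the bounded Kraus certificate of `surj_x8r0_17986l1_3`, verbatim), `3 ∤ Δ`, `#Ẽ(𝔽₃) = 1`. Binders: PUBLISHED `hCT`,
`hW`, `hGZK`, `hmod`; per pair `hr`, `hq`/`hv` (`#Ш_an = 9`), `hSel : Sel^(3)(E/ℚ) ≠ ⊥` — EVIDENCE: the landed
two-engine exact `3`-descent row of `17986l1` in `Supersingular/X8DescentRecords.lean` (`checked_x8_rankZero_sha9_desc3_4`;
`dim_𝔽₃ Sel^(3) = 2` on both engines, same subspace; cert `478b240c1bf1…`; kit j091546). Per pair; OFFER (the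
desk books); class X8 and crux 5 unchanged. [cite: Wuthrich2014, Prop. 21 (p. 400)]
[cite: SilvermanAEC2009, Thm. X.4.14 and VII.1 Remark 1.1] [cite: Miller2011LMS, §1 and Def. 1.1]
[cite: Cremona2006, Table 1 (Cremona label 17986l1)] -/
theorem X8.bsdp3_sel9_17986l1 (hCT : exists_casselsTate_pairing (K := ℚ)) (hW : sha_dvd_analyticSha)
    (hGZK : rank_eq_analyticRank_of_analyticRank_le_one) (hmod : hasEntireLFunction_rat)
    (W : WeierstrassCurve ℚ) (hWm : W = ⟨1, -1, 1, 165, -16391⟩) (hr : W.analyticRank = 0)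
    {q : ℚ} (hq : shaAn W = (q : ℂ)) (hv : padicValRat 3 q ≤ 2) (hSel : W.selmerGroup (3 : ℤ) ≠ ⊥) :
    BSDp W 3 := by
  subst hWm
  exact X8.bsdp_three_rankZero_of_ainvs_of_selmerGroup_ne_bot_of_surj hCT hW hGZK hmod
    1 (-1) 1 165 (-16391)
    (isGloballyMinimal_of_krausCriterion_bounded 1 (-1) 1 165 (-16391)
      (by decide +kernel) (by decide +kernel) (by decide +kernel))
    (by decide) (n₃ := 1) (by decide +kernel) (by decide) surj_x8r0_17986l1_3 hr hq hv hSel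

/-- **`BSD(E,3)` for `18032g1`** — X8 ∩ {r_an = 0} ∩ {surj(3)}, `#Ш_an = 9`; Cremona model `[0,0,0,-2695,-53851]`,
`N = 18032 = 2⁴·7²·23`, good supersingular at `3` with `a₃ = 3`, `ρ̄_{E,3}` onto (`surj_x8r0_18032g1_3`), `#E(ℚ)_tors = 1`,
`∏ c_ℓ = 2`. Kernel-decided: global minimality (the bounded Kraus certificate of `surj_x8r0_18032g1_3`, verbatim), `3 ∤ Δ`, `#Ẽ(𝔽₃) = 1`. Binders: PUBLISHED `hCT`,
`hW`, `hGZK`, `hmod`; per pair `hr`, `hq`/`hv` (`#Ш_an = 9`), `hSel : Sel^(3)(E/ℚ) ≠ ⊥` — EVIDENCE: the landed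
two-engine exact `3`-descent row of `18032g1` in `Supersingular/X8DescentRecords.lean` (`checked_x8_rankZero_sha9_desc3_4`;
`dim_𝔽₃ Sel^(3) = 2` on both engines, same subspace; cert `9f683e62480c…`; kit j091546). Per pair; OFFER (the
desk books); class X8 and crux 5 unchanged. [cite: Wuthrich2014, Prop. 21 (p. 400)]
[cite: SilvermanAEC2009, Thm. X.4.14 and VII.1 Remark 1.1] [cite: Miller2011LMS, §1 and Def. 1.1]
[cite: Cremona2006, Table 1 (Cremona label 18032g1)] -/
theorem X8.bsdp3_sel9_18032g1 (hCT : exists_casselsTate_pairing (K := ℚ)) (hW : sha_dvd_analyticSha)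
    (hGZK : rank_eq_analyticRank_of_analyticRank_le_one) (hmod : hasEntireLFunction_rat)
    (W : WeierstrassCurve ℚ) (hWm : W = ⟨0, 0, 0, -2695, -53851⟩) (hr : W.analyticRank = 0)
    {q : ℚ} (hq : shaAn W = (q : ℂ)) (hv : padicValRat 3 q ≤ 2) (hSel : W.selmerGroup (3 : ℤ) ≠ ⊥) :
    BSDp W 3 := by
  subst hWm
  exact X8.bsdp_three_rankZero_of_ainvs_of_selmerGroup_ne_bot_of_surj hCT hW hGZK hmod
    0 0 0 (-2695) (-53851)
    (isGloballyMinimal_of_krausCriterion_bounded 0 0 0 (-2695) (-53851)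
      (by decide +kernel) (by decide +kernel) (by decide +kernel))
    (by decide) (n₃ := 1) (by decide +kernel) (by decide) surj_x8r0_18032g1_3 hr hq hv hSel

/-- **`BSD(E,3)` for `18032h1`** — X8 ∩ {r_an = 0} ∩ {surj(3)}, `#Ш_an = 9`; Cremona model `[0,0,0,1196825,-12764985443]`,
`N = 18032 = 2⁴·7²·23`, good supersingular at `3` with `a₃ = −3`, `ρ̄_{E,3}` onto (`surj_x8r0_18032h1_3`), `#E(ℚ)_tors = 1`,
`∏ c_ℓ = 2`. Kernel-decided: global minimality (the bounded Kraus certificate of `surj_x8r0_18032h1_3`, verbatim), `3 ∤ Δ`, `#Ẽ(𝔽₃) = 7`. Binders: PUBLISHED `hCT`,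
`hW`, `hGZK`, `hmod`; per pair `hr`, `hq`/`hv` (`#Ш_an = 9`), `hSel : Sel^(3)(E/ℚ) ≠ ⊥` — EVIDENCE: the landed
two-engine exact `3`-descent row of `18032h1` in `Supersingular/X8DescentRecords.lean` (`checked_x8_rankZero_sha9_desc3_4`;
`dim_𝔽₃ Sel^(3) = 2` on both engines, same subspace; cert `ea13330eedf7…`; kit j091546). Per pair; OFFER (the
desk books); class X8 and crux 5 unchanged. [cite: Wuthrich2014, Prop. 21 (p. 400)]
[cite: SilvermanAEC2009, Thm. X.4.14 and VII.1 Remark 1.1] [cite: Miller2011LMS, §1 and Def. 1.1]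
[cite: Cremona2006, Table 1 (Cremona label 18032h1)] -/
theorem X8.bsdp3_sel9_18032h1 (hCT : exists_casselsTate_pairing (K := ℚ)) (hW : sha_dvd_analyticSha)
    (hGZK : rank_eq_analyticRank_of_analyticRank_le_one) (hmod : hasEntireLFunction_rat)
    (W : WeierstrassCurve ℚ) (hWm : W = ⟨0, 0, 0, 1196825, -12764985443⟩) (hr : W.analyticRank = 0)
    {q : ℚ} (hq : shaAn W = (q : ℂ)) (hv : padicValRat 3 q ≤ 2) (hSel : W.selmerGroup (3 : ℤ) ≠ ⊥) :
    BSDp W 3 := by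
  subst hWm
  exact X8.bsdp_three_rankZero_of_ainvs_of_selmerGroup_ne_bot_of_surj hCT hW hGZK hmod
    0 0 0 1196825 (-12764985443)
    (isGloballyMinimal_of_krausCriterion_bounded 0 0 0 1196825 (-12764985443)
      (by decide +kernel) (by decide +kernel) (by decide +kernel))
    (by decide) (n₃ := 7) (by decide +kernel) (by decide) surj_x8r0_18032h1_3 hr hq hv hSel

/-- **`BSD(E,3)` for `18515u1`** — X8 ∩ {r_an = 0} ∩ {surj(3)}, `#Ш_an = 9`; Cremona model `[0,0,1,-6877,-599225]`,
`N = 18515 = 5·7·23²`, good supersingular at `3` with `a₃ = 3`, `ρ̄_{E,3}` onto (`surj_x8r0_18515u1_3`), `#E(ℚ)_tors = 1`,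
`∏ c_ℓ = 6`. Kernel-decided: global minimality (the bounded Kraus certificate of `surj_x8r0_18515u1_3`, verbatim), `3 ∤ Δ`, `#Ẽ(𝔽₃) = 1`. Binders: PUBLISHED `hCT`,
`hW`, `hGZK`, `hmod`; per pair `hr`, `hq`/`hv` (`#Ш_an = 9`), `hSel : Sel^(3)(E/ℚ) ≠ ⊥` — EVIDENCE: the landed
two-engine exact `3`-descent row of `18515u1` in `Supersingular/X8DescentRecords.lean` (`checked_x8_rankZero_sha9_desc3_4`;
`dim_𝔽₃ Sel^(3) = 2` on both engines, same subspace; cert `75fa28932b89…`; kit j091546). Per pair; OFFER (the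
desk books); class X8 and crux 5 unchanged. [cite: Wuthrich2014, Prop. 21 (p. 400)]
[cite: SilvermanAEC2009, Thm. X.4.14 and VII.1 Remark 1.1] [cite: Miller2011LMS, §1 and Def. 1.1]
[cite: Cremona2006, Table 1 (Cremona label 18515u1)] -/
theorem X8.bsdp3_sel9_18515u1 (hCT : exists_casselsTate_pairing (K := ℚ)) (hW : sha_dvd_analyticSha)
    (hGZK : rank_eq_analyticRank_of_analyticRank_le_one) (hmod : hasEntireLFunction_rat)
    (W : WeierstrassCurve ℚ) (hWm : W = ⟨0, 0, 1, -6877, -599225⟩) (hr : W.analyticRank = 0)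
    {q : ℚ} (hq : shaAn W = (q : ℂ)) (hv : padicValRat 3 q ≤ 2) (hSel : W.selmerGroup (3 : ℤ) ≠ ⊥) :
    BSDp W 3 := by
  subst hWm
  exact X8.bsdp_three_rankZero_of_ainvs_of_selmerGroup_ne_bot_of_surj hCT hW hGZK hmod
    0 0 1 (-6877) (-599225)
    (isGloballyMinimal_of_krausCriterion_bounded 0 0 1 (-6877) (-599225)
      (by decide +kernel) (by decide +kernel) (by decide +kernel))
    (by decide) (n₃ := 1) (by decide +kernel) (by decide) surj_x8r0_18515u1_3 hr hq hv hSel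

/-- **`BSD(E,3)` for `18656b1`** — X8 ∩ {r_an = 0} ∩ {surj(3)}, `#Ш_an = 9`; Cremona model `[0,0,0,-67,-358]`,
`N = 18656 = 2⁵·11·53`, good supersingular at `3` with `a₃ = 3`, `ρ̄_{E,3}` onto (`surj_x8r0_18656b1_3`), `#E(ℚ)_tors = 1`,
`∏ c_ℓ = 1`. Kernel-decided: global minimality (the bounded Kraus certificate of `surj_x8r0_18656b1_3`, verbatim), `3 ∤ Δ`, `#Ẽ(𝔽₃) = 1`. Binders: PUBLISHED `hCT`,
`hW`, `hGZK`, `hmod`; per pair `hr`, `hq`/`hv` (`#Ш_an = 9`), `hSel : Sel^(3)(E/ℚ) ≠ ⊥` — EVIDENCE: the landed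
two-engine exact `3`-descent row of `18656b1` in `Supersingular/X8DescentRecords.lean` (`checked_x8_rankZero_sha9_desc3_4`;
`dim_𝔽₃ Sel^(3) = 2` on both engines, same subspace; cert `a960605b0b2c…`; kit j091546). Per pair; OFFER (the
desk books); class X8 and crux 5 unchanged. [cite: Wuthrich2014, Prop. 21 (p. 400)]
[cite: SilvermanAEC2009, Thm. X.4.14 and VII.1 Remark 1.1] [cite: Miller2011LMS, §1 and Def. 1.1]
[cite: Cremona2006, Table 1 (Cremona label 18656b1)] -/
theorem X8.bsdp3_sel9_18656b1 (hCT : exists_casselsTate_pairing (K := ℚ)) (hW : sha_dvd_analyticSha)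
    (hGZK : rank_eq_analyticRank_of_analyticRank_le_one) (hmod : hasEntireLFunction_rat)
    (W : WeierstrassCurve ℚ) (hWm : W = ⟨0, 0, 0, -67, -358⟩) (hr : W.analyticRank = 0)
    {q : ℚ} (hq : shaAn W = (q : ℂ)) (hv : padicValRat 3 q ≤ 2) (hSel : W.selmerGroup (3 : ℤ) ≠ ⊥) :
    BSDp W 3 := by
  subst hWm
  exact X8.bsdp_three_rankZero_of_ainvs_of_selmerGroup_ne_bot_of_surj hCT hW hGZK hmod
    0 0 0 (-67) (-358)
    (isGloballyMinimal_of_krausCriterion_bounded 0 0 0 (-67) (-358)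
      (by decide +kernel) (by decide +kernel) (by decide +kernel))
    (by decide) (n₃ := 1) (by decide +kernel) (by decide) surj_x8r0_18656b1_3 hr hq hv hSel

/-- **`BSD(E,3)` for `19600eb1`** — X8 ∩ {r_an = 0} ∩ {surj(3)}, `#Ш_an = 9`; Cremona model `[0,0,0,300125,1155481250]`,
`N = 19600 = 2⁴·5²·7²`, good supersingular at `3` with `a₃ = 3`, `ρ̄_{E,3}` onto (`surj_x8r0_19600eb1_3`), `#E(ℚ)_tors = 1`,
`∏ c_ℓ = 4`. Kernel-decided: global minimality (the bounded Kraus certificate of `surj_x8r0_19600eb1_3`, verbatim), `3 ∤ Δ`, `#Ẽ(𝔽₃) = 1`. Binders: PUBLISHED `hCT`,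
`hW`, `hGZK`, `hmod`; per pair `hr`, `hq`/`hv` (`#Ш_an = 9`), `hSel : Sel^(3)(E/ℚ) ≠ ⊥` — EVIDENCE: the landed
two-engine exact `3`-descent row of `19600eb1` in `Supersingular/X8DescentRecords.lean` (`checked_x8_rankZero_sha9_desc3_4`;
`dim_𝔽₃ Sel^(3) = 2` on both engines, same subspace; cert `964fb119a4ff…`; kit j091546). Per pair; OFFER (the
desk books); class X8 and crux 5 unchanged. [cite: Wuthrich2014, Prop. 21 (p. 400)]
[cite: SilvermanAEC2009, Thm. X.4.14 and VII.1 Remark 1.1] [cite: Miller2011LMS, §1 and Def. 1.1]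
[cite: Cremona2006, Table 1 (Cremona label 19600eb1)] -/
theorem X8.bsdp3_sel9_19600eb1 (hCT : exists_casselsTate_pairing (K := ℚ)) (hW : sha_dvd_analyticSha)
    (hGZK : rank_eq_analyticRank_of_analyticRank_le_one) (hmod : hasEntireLFunction_rat)
    (W : WeierstrassCurve ℚ) (hWm : W = ⟨0, 0, 0, 300125, 1155481250⟩) (hr : W.analyticRank = 0)
    {q : ℚ} (hq : shaAn W = (q : ℂ)) (hv : padicValRat 3 q ≤ 2) (hSel : W.selmerGroup (3 : ℤ) ≠ ⊥) :
    BSDp W 3 := by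
  subst hWm
  exact X8.bsdp_three_rankZero_of_ainvs_of_selmerGroup_ne_bot_of_surj hCT hW hGZK hmod
    0 0 0 300125 1155481250
    (isGloballyMinimal_of_krausCriterion₃_bounded 0 0 0 300125 1155481250
      (by decide +kernel) (by decide +kernel)
      (by set_option synthInstance.maxSize 2000 in decide +kernel))
    (by decide) (n₃ := 1) (by decide +kernel) (by decide) surj_x8r0_19600eb1_3 hr hq hv hSel

/-- **`BSD(E,3)` for `19760m1`** — X8 ∩ {r_an = 0} ∩ {surj(3)}, `#Ш_an = 9`; Cremona model `[0,0,0,872,7127]`,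
`N = 19760 = 2⁴·5·13·19`, good supersingular at `3` with `a₃ = 3`, `ρ̄_{E,3}` onto (`surj_x8r0_19760m1_3`), `#E(ℚ)_tors = 1`,
`∏ c_ℓ = 1`. Kernel-decided: global minimality (the bounded Kraus certificate of `surj_x8r0_19760m1_3`, verbatim), `3 ∤ Δ`, `#Ẽ(𝔽₃) = 1`. Binders: PUBLISHED `hCT`,
`hW`, `hGZK`, `hmod`; per pair `hr`, `hq`/`hv` (`#Ш_an = 9`), `hSel : Sel^(3)(E/ℚ) ≠ ⊥` — EVIDENCE: the landed
two-engine exact `3`-descent row of `19760m1` in `Supersingular/X8DescentRecords.lean` (`checked_x8_rankZero_sha9_desc3_5`;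
`dim_𝔽₃ Sel^(3) = 2` on both engines, same subspace; cert `6dd67597f9de…`; kit j091546). Per pair; OFFER (the
desk books); class X8 and crux 5 unchanged. [cite: Wuthrich2014, Prop. 21 (p. 400)]
[cite: SilvermanAEC2009, Thm. X.4.14 and VII.1 Remark 1.1] [cite: Miller2011LMS, §1 and Def. 1.1]
[cite: Cremona2006, Table 1 (Cremona label 19760m1)] -/
theorem X8.bsdp3_sel9_19760m1 (hCT : exists_casselsTate_pairing (K := ℚ)) (hW : sha_dvd_analyticSha)
    (hGZK : rank_eq_analyticRank_of_analyticRank_le_one) (hmod : hasEntireLFunction_rat)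
    (W : WeierstrassCurve ℚ) (hWm : W = ⟨0, 0, 0, 872, 7127⟩) (hr : W.analyticRank = 0)
    {q : ℚ} (hq : shaAn W = (q : ℂ)) (hv : padicValRat 3 q ≤ 2) (hSel : W.selmerGroup (3 : ℤ) ≠ ⊥) :
    BSDp W 3 := by
  subst hWm
  exact X8.bsdp_three_rankZero_of_ainvs_of_selmerGroup_ne_bot_of_surj hCT hW hGZK hmod
    0 0 0 872 7127
    (isGloballyMinimal_of_krausCriterion_bounded 0 0 0 872 7127
      (by decide +kernel) (by decide +kernel) (by decide +kernel))
    (by decide) (n₃ := 1) (by decide +kernel) (by decide) surj_x8r0_19760m1_3 hr hq hv hSel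

end Summit.BirchSwinnertonDyer.BirchSwinnertonDyer.Theorems

end
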